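import Summits.BirchSwinnertonDyer.BirchSwinnertonDyer.Theorems.PrintCFramBottomClassIndexLawFiveLeCuspSeedEulerFactorSeries
import Summits.BirchSwinnertonDyer.BirchSwinnertonDyer.Theorems.PrintCFramBottomClassIndexLawFiveLeCuspSeedCohenTLSeries
import Mathlib.NumberTheory.LSeries.Linearity
import Literature.NumberTheory.LFunctions.RankinEisensteinFactorisation
import HarnessLib

set_option autoImplicit false

/-!
# Crux `PrintCFram.BottomClassIndexLawFiveLe` (stmt-BirchSwinnertonDyer-20372), line `eisenstein-resource-bdp-line` (registry v24):
# (E3) OF THE CUSP-CONJUNCT ASSEMBLY, ALGEBRAIC PART 2 — THE COLLAPSE OF THE `(a, b)` DOUBLE SUM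
# `Σ_{(a,b)} [χ_e(a)a^{−k}]·[𝟙_{b⊥6m}μ(b)χ_e(b)b^{−(k+2)}]·([ab = □]·C₀·Π_{ℓ∣ab, ℓ∤6m} ℓ/(ℓ+1)) = C₀·L(𝟙_{⊥6m}μ, 2k+1)·L(𝟙_{⊥m}, 2k)`
# (cell `bsd-print-cfram`, width seat `bsd-line-cfram-p1-w5` g6; THEOREMS ONLY, `--supports` 20372; BSD is not proved by any of this)

HONEST FRAMING. Elementary, raw-`LSeries` currency; nothing modular. This is the algebraic half of (E3) of the proof plan for the cusp
conjunct «`G = 0 ⟹ ι C = 0`» of the registered stub `stub_cuspCutForm` (crux notes `Lines/eisenstein-resource-bdp-line-w5g5-cusp-seed.md`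
§4 (iii) `⟨Φ⟩ = Π_ℓ (1 − ℓ^{−2k−1})/(1 − ℓ^{−2k})` and §5): after unfolding `L(F_e, s)` along `a = m N f²` (E2), expanding Lemma B (E1)
and `L(k, χ_D)` and averaging over the family `N` with w3 g13's (III) in its Euler form
(`FamilyMean.tendsto_sub_one_mul_LSeries_family_euler`: mean of `J(n | N)` = `[n = □]·(L(𝟙_{⊥6m}μ,2)·κ_m)·Π_{ℓ∣n, ℓ∤6m} ℓ/(ℓ+1)`),
the limit is the `(a, b)` double sum of the title with `C₀ = L(𝟙_{⊥6m}μ, 2)·κ_m`. THIS FILE evaluates it WITHOUT Euler products: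

* `tsum_term_mul_term_mul_apply_mul` — fiberwise summation along `(a,b) ↦ ab` (Mathlib `HasSum.tsum_fiberwise`, `term_convolution'`);
* `chiDisc_eq_zero_iff`, `chiDisc_mul_self` — `χ_e(c²) = 𝟙_{c ⊥ m}` for `|e| = m`;
* `convolution_chiDisc_moebius_apply` — the fibre over `n` is `χ_e(n)·Σ_{b∣n, b⊥6m} μ(b) b^{−2}`; with `n = c²` this is
  `𝟙_{c⊥m}·Π_{ℓ∣c,ℓ∤6m}(1 − ℓ^{−2})` (part 1), and `(1 − ℓ^{−2})·ℓ/(ℓ+1) = 1 − ℓ^{−1}`;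
* `LSeries_alongSquares` (tree, `Literature.NumberTheory.LFunctions.RankinEisenstein`) turns `Σ_{n = □}` into `L(·, 2k)`;
* **`tsum_term_chiDisc_mul_term_mul_isSquare_eq`** — THE COLLAPSE (title identity), via part 1's `LSeries_eulerFactorSeq_eq`.

Afterwards `C₀·L(𝟙_{⊥6m}μ,2k+1)·L(𝟙_{⊥m},2k)` meets Lemma B's `ζ^{(6m)}(2)ζ^{(6m)}(2k+1)`: both `L(𝟙_{⊥6m},s)·L(𝟙_{⊥6m}μ,s) = 1` cancellations
(w3 g13 `FamilyMean.LSeries_coprime_mul_LSeries_coprimeMoebius`) leave `κ_m · L(𝟙_{⊥m}, 2k) = κ_m ζ(2k) Π_{q∣m}(1 − q^{−2k})` — w5 g5 §0.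
[folklore] References: [MontgomeryVaughan2007] §1.3; [IrelandRosen1982] Ch. 2 §2.
-/

-- summit-side namespace `Summit.BirchSwinnertonDyer.BirchSwinnertonDyer.…` (single-conjunct summit, D-0017 layout)
set_option linter.dupNamespace false

namespace Summit.BirchSwinnertonDyer.BirchSwinnertonDyer.Theorems.PrintCFram.CuspSeed

open LSeries ArithmeticFunction Finset Literature.NumberTheory.ModularForms.CohenEisenstein
  Literature.NumberTheory.LFunctions.RankinEisenstein
open scoped LSeries.notation ArithmeticFunction.Moebius ArithmeticFunction.zeta

/-! ## §3 Fiberwise summation along `(a, b) ↦ ab` -/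

/-- **Fiberwise summation.** For an absolutely summable family on `ℕ × ℕ` of the shape `term f s a · term g s b · H(ab)`:
`Σ_{(a,b)} term f s a · term g s b · H(ab) = Σ_n H(n) · term (f ⋆ g) s n` (Mathlib `HasSum.tsum_fiberwise` + `term_convolution'`).
[folklore] -/
theorem tsum_term_mul_term_mul_apply_mul (f g H : ℕ → ℂ) (s : ℂ)
    (hsum : Summable fun x : ℕ × ℕ ↦ term f s x.1 * term g s x.2 * H (x.1 * x.2)) :
    ∑' x : ℕ × ℕ, term f s x.1 * term g s x.2 * H (x.1 * x.2) = ∑' n : ℕ, H n * term (f ⍟ g) s n := by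
  rw [← (hsum.hasSum.tsum_fiberwise (fun x : ℕ × ℕ ↦ x.1 * x.2)).tsum_eq]
  refine tsum_congr fun n ↦ ?_
  rw [term_convolution' f g s]
  simp only
  rw [← tsum_mul_left]
  refine tsum_congr fun b ↦ ?_
  obtain ⟨⟨a, c⟩, hb⟩ := b
  have hac : a * c = n := hb
  simp only
  rw [hac]
  ring

/-! ## §4 The Kronecker symbol on squares -/

/-- For `e ≡ 1 (mod 4)` or `4 ∣ e` with `|e| = m ≥ 1`: `χ_e(c) = 0 ↔ c` is not prime to `m`. [cite: MontgomeryVaughan2007, Thm. 9.13] -/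
theorem chiDisc_eq_zero_iff {e : ℤ} (he : e % 4 = 1 ∨ 4 ∣ e) {m : ℕ} (hme : e.natAbs = m) (hm : m ≠ 0) (c : ℕ) :
    chiDisc e c = 0 ↔ ¬ c.Coprime m := by
  haveI : NeZero m := ⟨hm⟩
  rcases he with h1 | h4
  · rw [chiDisc_of_emod_four_eq_one h1, hme, jacobiSym.eq_zero_iff_not_coprime, Int.gcd_natCast_natCast]
  · have h1 : e % 4 ≠ 1 := by omega
    have hm2 : 2 ∣ m := by
      rw [← hme]
      exact Int.natAbs_dvd_natAbs.mpr (dvd_trans (⟨2, by norm_num⟩ : (2 : ℤ) ∣ 4) h4)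
    rcases Nat.even_or_odd c with hc | hc
    · rw [chiDisc_of_emod_four_ne_one_of_even h1 hc]
      simp only [true_iff]
      intro hcm
      have := Nat.dvd_gcd (even_iff_two_dvd.mp hc) hm2
      rw [hcm] at this
      omega
    · haveI : NeZero c := ⟨hc.pos.ne'⟩
      rw [chiDisc_of_emod_four_ne_one_of_odd h1 hc, jacobiSym.eq_zero_iff_not_coprime, Int.gcd_comm,
        show Int.gcd (c : ℤ) e = Nat.gcd c m by rw [Int.gcd_eq_natAbs, Int.natAbs_natCast, hme]]

/-- For such `e`: `χ_e(c²) = 𝟙_{c ⊥ m}`. [cite: MontgomeryVaughan2007, Thm. 9.13] -/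
theorem chiDisc_mul_self {e : ℤ} (he : e % 4 = 1 ∨ 4 ∣ e) {m : ℕ} (hme : e.natAbs = m) (hm : m ≠ 0) (c : ℕ) :
    (chiDisc e (c * c) : ℂ) = if c.Coprime m then 1 else 0 := by
  rw [chiDisc_mul_right]
  split_ifs with hc
  · have hne : chiDisc e c ≠ 0 := fun h ↦ ((chiDisc_eq_zero_iff he hme hm c).mp h) hc
    rcases chiDisc_trichotomy e c with h | h | h
    · exact absurd h hne
    · rw [h]; norm_num
    · rw [h]; norm_num
  · rw [(chiDisc_eq_zero_iff he hme hm c).mpr hc]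
    norm_num


/-! ## §5 THE COLLAPSE of the `(a, b)` double sum -/

/-- Norm bound `|Π_{ℓ ∈ S} ℓ/(ℓ+1)| ≤ 1` for a finite set of naturals `S`. [folklore] -/
theorem norm_prod_div_add_one_le_one (S : Finset ℕ) : ‖∏ ℓ ∈ S, ((ℓ : ℂ) / ((ℓ : ℂ) + 1))‖ ≤ 1 := by
  rw [norm_prod]
  refine Finset.prod_le_one (fun _ _ ↦ norm_nonneg _) fun ℓ _ ↦ ?_
  rw [norm_div, Complex.norm_natCast, show ((ℓ : ℂ) + 1) = ((ℓ + 1 : ℕ) : ℂ) by push_cast; ring, Complex.norm_natCast]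
  rw [div_le_one (by positivity)]
  exact_mod_cast Nat.le_succ ℓ

/-- Summability of the `(a,b)` double family at the limit point. [folklore] -/
theorem summable_term_mul_term_mul_isSquare {e : ℤ} {m : ℕ} {k : ℕ} (hk : 2 ≤ k) (C₀ : ℂ) (g : ℕ → ℂ)
    (hg : ∀ b, ‖g b‖ ≤ 1) :
    Summable fun x : ℕ × ℕ ↦ term (fun a : ℕ ↦ (chiDisc e a : ℂ)) k x.1 * term g k x.2 *
      (if IsSquare (x.1 * x.2) then C₀ * ∏ ℓ ∈ (x.1 * x.2).primeFactors \ (6 * m).primeFactors, ((ℓ : ℂ) / ((ℓ : ℂ) + 1))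
        else 0) := by
  have hk1 : (1 : ℝ) < (k : ℂ).re := by simp only [Complex.natCast_re]; exact_mod_cast hk
  have h1 : Summable fun n : ℕ ↦ ‖term (fun _ : ℕ ↦ (1 : ℂ)) k n‖ :=
    (LSeriesSummable_of_le_const_mul_rpow hk1 ⟨1, fun n _ ↦ by simp⟩).norm
  have h2 := (Summable.mul_of_nonneg h1 h1 (fun _ ↦ norm_nonneg _) (fun _ ↦ norm_nonneg _)).mul_left ‖C₀‖
  refine Summable.of_norm_bounded h2 fun x ↦ ?_
  rw [norm_mul, norm_mul]
  have ha : ‖term (fun a : ℕ ↦ (chiDisc e a : ℂ)) k x.1‖ ≤ ‖term (fun _ : ℕ ↦ (1 : ℂ)) k x.1‖ := by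
    refine norm_term_le k ?_
    rcases chiDisc_trichotomy e x.1 with h | h | h <;> rw [h] <;> simp
  have hb : ‖term g k x.2‖ ≤ ‖term (fun _ : ℕ ↦ (1 : ℂ)) k x.2‖ := norm_term_le k (by simpa using hg x.2)
  have hH : ‖(if IsSquare (x.1 * x.2) then C₀ * ∏ ℓ ∈ (x.1 * x.2).primeFactors \ (6 * m).primeFactors,
      ((ℓ : ℂ) / ((ℓ : ℂ) + 1)) else 0)‖ ≤ ‖C₀‖ := by
    split_ifs
    · rw [norm_mul]
      exact mul_le_of_le_one_right (norm_nonneg _) (norm_prod_div_add_one_le_one _)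
    · rw [norm_zero]; exact norm_nonneg _
  calc ‖term (fun a : ℕ ↦ (chiDisc e a : ℂ)) k x.1‖ * ‖term g k x.2‖ * ‖_‖
      ≤ ‖term (fun _ : ℕ ↦ (1 : ℂ)) k x.1‖ * ‖term (fun _ : ℕ ↦ (1 : ℂ)) k x.2‖ * ‖C₀‖ := by
        gcongr
    _ = ‖C₀‖ * (‖term (fun _ : ℕ ↦ (1 : ℂ)) k x.1‖ * ‖term (fun _ : ℕ ↦ (1 : ℂ)) k x.2‖) := by ring


/-- The convolution `χ_e ⋆ (𝟙_{⊥M} μ χ_e id^{−2})` at `n ≥ 1` is `χ_e(n) · Σ_{b ∣ n, b ⊥ M} μ(b) b^{−2}`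
(complete multiplicativity of `χ_e`; at `n = 0` both sides vanish). [folklore] -/
theorem convolution_chiDisc_moebius_apply (e : ℤ) (M n : ℕ) :
    ((fun a : ℕ ↦ (chiDisc e a : ℂ)) ⍟
        (fun b : ℕ ↦ (if b.Coprime M then (μ b : ℂ) * (chiDisc e b : ℂ) else 0) * ((b : ℂ) ^ 2)⁻¹)) n =
      (chiDisc e n : ℂ) * ∑ b ∈ n.divisors, (μ b : ℂ) * (if b.Coprime M then ((b : ℂ) ^ 2)⁻¹ else 0) := by
  rw [convolution_def]
  simp only
  rw [Nat.sum_divisorsAntidiagonal' (f := fun a b ↦ (chiDisc e a : ℂ) *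
      ((if b.Coprime M then (μ b : ℂ) * (chiDisc e b : ℂ) else 0) * ((b : ℂ) ^ 2)⁻¹)) (n := n), Finset.mul_sum]
  refine Finset.sum_congr rfl fun b hb ↦ ?_
  have hbn : n / b * b = n := Nat.div_mul_cancel (Nat.dvd_of_mem_divisors hb)
  have hχ : (chiDisc e (n / b) : ℂ) * chiDisc e b = chiDisc e n := by
    rw [← Int.cast_mul, ← chiDisc_mul_right, hbn]
  split_ifs with hcop
  · rw [← hχ]; ring
  · simp

/-- Moving `b^{−2}` from the exponent into the coefficient: `term g (k+2) b = term (g · id^{−2}) k b`. [folklore] -/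
theorem term_add_two_eq (g : ℕ → ℂ) (k : ℂ) (b : ℕ) :
    term g (k + 2) b = term (fun b : ℕ ↦ g b * ((b : ℂ) ^ 2)⁻¹) k b := by
  rcases eq_or_ne b 0 with rfl | hb
  · simp
  · have hbc : (b : ℂ) ≠ 0 := Nat.cast_ne_zero.mpr hb
    rw [term_of_ne_zero hb, term_of_ne_zero hb, Complex.cpow_add _ _ hbc, Complex.cpow_two]
    field_simp

/-- Norm bound `|𝟙_{b⊥M} μ(b) χ_e(b) b^{−2}| ≤ 1`. [folklore] -/
theorem norm_moebius_chiDisc_div_sq_le (e : ℤ) (M b : ℕ) :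
    ‖(if b.Coprime M then (μ b : ℂ) * (chiDisc e b : ℂ) else 0) * ((b : ℂ) ^ 2)⁻¹‖ ≤ 1 := by
  rcases eq_or_ne b 0 with rfl | hb
  · simp
  have hb1 : (1 : ℝ) ≤ (b : ℝ) := by exact_mod_cast Nat.one_le_iff_ne_zero.mpr hb
  have hinv : ‖((b : ℂ) ^ 2)⁻¹‖ ≤ 1 := by
    rw [norm_inv, norm_pow, Complex.norm_natCast]
    exact inv_le_one_of_one_le₀ (one_le_pow₀ hb1)
  split_ifs
  · rw [norm_mul, norm_mul, Complex.norm_intCast, Complex.norm_intCast]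
    have h1 : |(μ b : ℝ)| ≤ 1 := by exact_mod_cast abs_moebius_le_one
    have h2 : |(chiDisc e b : ℝ)| ≤ 1 := by rcases chiDisc_trichotomy e b with h | h | h <;> rw [h] <;> simp
    calc |(μ b : ℝ)| * |(chiDisc e b : ℝ)| * ‖((b : ℂ) ^ 2)⁻¹‖ ≤ 1 * 1 * 1 := by gcongr
      _ = 1 := by ring
  · simp

/-- The `n`-sequence after the fiberwise summation is `term (sq G) k n` with
`G(c) = C₀ · 𝟙_{c⊥m} · Π_{ℓ∣c, ℓ∤6m} (1 − ℓ^{−1})`. [folklore] -/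
theorem isSquare_mul_term_convolution_eq {e : ℤ} (he : e % 4 = 1 ∨ 4 ∣ e) {m : ℕ} (hme : e.natAbs = m) (hm : m ≠ 0)
    (k C₀ : ℂ) (n : ℕ) :
    (if IsSquare n then C₀ * ∏ ℓ ∈ n.primeFactors \ (6 * m).primeFactors, ((ℓ : ℂ) / ((ℓ : ℂ) + 1)) else 0) *
        term ((fun a : ℕ ↦ (chiDisc e a : ℂ)) ⍟
          (fun b : ℕ ↦ (if b.Coprime (6 * m) then (μ b : ℂ) * (chiDisc e b : ℂ) else 0) * ((b : ℂ) ^ 2)⁻¹)) k n =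
      term (alongSquares fun c : ℕ ↦ C₀ * (if c.Coprime m then
        ∏ ℓ ∈ c.primeFactors \ (6 * m).primeFactors, (1 - ((ℓ : ℂ) ^ 1)⁻¹) else 0)) k n := by
  have h6m : 6 * m ≠ 0 := mul_ne_zero (by norm_num) hm
  rcases eq_or_ne n 0 with rfl | hn
  · simp
  rw [term_of_ne_zero hn, term_of_ne_zero hn, convolution_chiDisc_moebius_apply e (6 * m) n]
  by_cases hsqn : IsSquare n
  · obtain ⟨c, rfl⟩ := hsqn
    have hc : c ≠ 0 := by rintro rfl; exact hn (by simp)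
    rw [if_pos ⟨c, rfl⟩, alongSquares_mul_self, chiDisc_mul_self he hme hm, ← sq,
      sum_divisors_sq_moebius_ite_coprime_eq_prod h6m 2 hc, Nat.primeFactors_pow _ two_ne_zero]
    split_ifs with hcm
    · have hprod : (∏ ℓ ∈ c.primeFactors \ (6 * m).primeFactors, ((ℓ : ℂ) / ((ℓ : ℂ) + 1))) *
          ∏ ℓ ∈ c.primeFactors \ (6 * m).primeFactors, (1 - ((ℓ : ℂ) ^ 2)⁻¹) =
          ∏ ℓ ∈ c.primeFactors \ (6 * m).primeFactors, (1 - ((ℓ : ℂ) ^ 1)⁻¹) := by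
        rw [← Finset.prod_mul_distrib]
        refine Finset.prod_congr rfl fun ℓ hℓ ↦ ?_
        have hℓ0 : (ℓ : ℂ) ≠ 0 := Nat.cast_ne_zero.mpr (Nat.prime_of_mem_primeFactors (Finset.mem_sdiff.mp hℓ).1).ne_zero
        have hℓ1 : (ℓ : ℂ) + 1 ≠ 0 := by
          rw [show ((ℓ : ℂ) + 1) = ((ℓ + 1 : ℕ) : ℂ) by push_cast; ring]
          exact Nat.cast_ne_zero.mpr (Nat.succ_ne_zero ℓ)
        field_simp
        ring
      rw [one_mul, ← mul_div_assoc, mul_assoc, hprod]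
    · simp
  · rw [if_neg hsqn, alongSquares_of_not_isSquare _ hsqn]
    simp

/-- **THE COLLAPSE.** For `e ≡ 1 (mod 4)` or `4 ∣ e` with `|e| = m ≥ 1`, `k ≥ 2` and any constant `C₀`:
`Σ_{(a,b)} [χ_e(a) a^{−k}]·[𝟙_{b⊥6m} μ(b) χ_e(b) b^{−(k+2)}]·([ab = □]·C₀·Π_{ℓ∣ab, ℓ∤6m} ℓ/(ℓ+1))
= C₀ · L(𝟙_{⊥6m}μ, 2k+1) · L(𝟙_{⊥m}, 2k)` — the `(a, b)` double sum of the cusp-constant computation after the family average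
(crux notes `Lines/eisenstein-resource-bdp-line-w5g5-cusp-seed.md` §4 (iii) `⟨Φ⟩` and §5), evaluated WITHOUT Euler products:
fiberwise along `ab = n = c²`, `χ_e(c²) = 𝟙_{c⊥m}`, `Σ_{b∣c², b⊥6m} μ(b)b^{−2} = Π(1 − ℓ^{−2})`, `(1 − ℓ^{−2})·ℓ/(ℓ+1) = 1 − ℓ^{−1}`,
and `Σ_{c⊥m} c^{−2k} Π(1 − ℓ^{−1}) = L(𝟙_{⊥6m}μ, 2k+1)·L(𝟙_{⊥m}, 2k)` (`LSeries_eulerFactorSeq_eq`). [folklore] -/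
theorem tsum_term_chiDisc_mul_term_mul_isSquare_eq {e : ℤ} (he : e % 4 = 1 ∨ 4 ∣ e) {m : ℕ} (hme : e.natAbs = m)
    (hm : m ≠ 0) {k : ℕ} (hk : 2 ≤ k) (C₀ : ℂ) :
    ∑' x : ℕ × ℕ, term (fun a : ℕ ↦ (chiDisc e a : ℂ)) k x.1 *
        term (fun b : ℕ ↦ if b.Coprime (6 * m) then (μ b : ℂ) * (chiDisc e b : ℂ) else 0) ((k : ℂ) + 2) x.2 *
        (if IsSquare (x.1 * x.2) then C₀ * ∏ ℓ ∈ (x.1 * x.2).primeFactors \ (6 * m).primeFactors, ((ℓ : ℂ) / ((ℓ : ℂ) + 1))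
          else 0) =
      C₀ * (LSeries (fun b : ℕ ↦ if b.Coprime (6 * m) then (μ b : ℂ) else 0) (2 * k + 1) *
        LSeries (fun a : ℕ ↦ if a.Coprime m then (1 : ℂ) else 0) (2 * k)) := by
  -- abstract the weight `H(ab)` so that the fiberwise lemma applies syntactically
  suffices main : ∀ H : ℕ → ℂ, H = (fun n : ℕ ↦ if IsSquare n then
      C₀ * ∏ ℓ ∈ n.primeFactors \ (6 * m).primeFactors, ((ℓ : ℂ) / ((ℓ : ℂ) + 1)) else 0) →
      ∑' x : ℕ × ℕ, term (fun a : ℕ ↦ (chiDisc e a : ℂ)) k x.1 *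
        term (fun b : ℕ ↦ if b.Coprime (6 * m) then (μ b : ℂ) * (chiDisc e b : ℂ) else 0) ((k : ℂ) + 2) x.2 * H (x.1 * x.2) =
      C₀ * (LSeries (fun b : ℕ ↦ if b.Coprime (6 * m) then (μ b : ℂ) else 0) (2 * k + 1) *
        LSeries (fun a : ℕ ↦ if a.Coprime m then (1 : ℂ) else 0) (2 * k)) by
    have h := main _ rfl
    simpa only using h
  intro H hH
  have h1 : ∀ x : ℕ × ℕ, term (fun a : ℕ ↦ (chiDisc e a : ℂ)) k x.1 *
        term (fun b : ℕ ↦ if b.Coprime (6 * m) then (μ b : ℂ) * (chiDisc e b : ℂ) else 0) ((k : ℂ) + 2) x.2 * H (x.1 * x.2) =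
      term (fun a : ℕ ↦ (chiDisc e a : ℂ)) k x.1 *
        term (fun b : ℕ ↦ (if b.Coprime (6 * m) then (μ b : ℂ) * (chiDisc e b : ℂ) else 0) * ((b : ℂ) ^ 2)⁻¹) k x.2 *
        H (x.1 * x.2) := fun x ↦ by rw [term_add_two_eq]
  have hsum : Summable fun x : ℕ × ℕ ↦ term (fun a : ℕ ↦ (chiDisc e a : ℂ)) k x.1 *
      term (fun b : ℕ ↦ (if b.Coprime (6 * m) then (μ b : ℂ) * (chiDisc e b : ℂ) else 0) * ((b : ℂ) ^ 2)⁻¹) k x.2 *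
      H (x.1 * x.2) := by
    subst hH
    exact summable_term_mul_term_mul_isSquare hk C₀ _ (norm_moebius_chiDisc_div_sq_le e (6 * m))
  rw [tsum_congr h1, tsum_term_mul_term_mul_apply_mul (fun a : ℕ ↦ (chiDisc e a : ℂ))
    (fun b : ℕ ↦ (if b.Coprime (6 * m) then (μ b : ℂ) * (chiDisc e b : ℂ) else 0) * ((b : ℂ) ^ 2)⁻¹) H k hsum]
  subst hH
  rw [tsum_congr (isSquare_mul_term_convolution_eq he hme hm k C₀)]
  set G : ℕ → ℂ := fun c : ℕ ↦ C₀ * (if c.Coprime m then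
    ∏ ℓ ∈ c.primeFactors \ (6 * m).primeFactors, (1 - ((ℓ : ℂ) ^ 1)⁻¹) else 0) with hG
  have hL : ∑' n : ℕ, term (alongSquares G) (k : ℂ) n = LSeries (alongSquares G) k := rfl
  rw [hL, LSeries_alongSquares]
  have hsm : LSeries G (2 * (k : ℂ)) = C₀ * LSeries (fun c : ℕ ↦ if c.Coprime m then
      ∏ ℓ ∈ c.primeFactors \ (6 * m).primeFactors, (1 - ((ℓ : ℂ) ^ 1)⁻¹) else 0) (2 * (k : ℂ)) := by
    rw [← LSeries_smul]
    rfl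
  have hre : 1 < (2 * (k : ℂ)).re := by
    have : (2 : ℝ) ≤ k := by exact_mod_cast hk
    simp only [Complex.mul_re, Complex.re_ofNat, Complex.natCast_re, Complex.im_ofNat, Complex.natCast_im, mul_zero,
      sub_zero]
    linarith
  rw [hsm, LSeries_eulerFactorSeq_eq hm hre]

end Summit.BirchSwinnertonDyer.BirchSwinnertonDyer.Theorems.PrintCFram.CuspSeed
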